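import Summits.CriticalPhenomena.PercolationContinuityZ3.Theorems.PercNearOneGluingNoHeavyLowerTailSahiCombFiveUpSetProof
import Summits.CriticalPhenomena.PercolationContinuityZ3.Theorems.PercNearOneGluingNoHeavyLowerTailSahiCombFiveUpSetLattice

/-!
# The three-set face of the five-up-set inequality in SPLICE form: four up-sets, no cut, no hybrid set

Support file of the one-cut programme (crux `NoHeavyLowerTail`, stmt-CriticalPhenomena-4575; lemma factory `prim-lf-1` gen 35,
memo `FROM-prim-lf-1-gen35-SPLICE-FORM-AND-HYBRID-LAW.md` §1).  The open core of the five-up-set inequality (♠) was isolated by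
cell `prim-masterthm` seat P5 (report `P5-LORENTZIAN-TEST.md` §12.4) as the HYBRID KLEITMAN inequality (★3′)
`#(U ∩ refl X ∩ hybrid B D) ≤ #(U ∩ X ∩ B)` (`FiveUpSet.HybridKleitmanIneq`, a theorem on cubes since prim-lf-1 gen 17's rank proof,
`FiveUpSet.hybridKleitmanIneq_holds`; OPEN on general finite distributive lattices, where the rank argument fails).  Only `U ∩ D`
enters (★3′), so the cut `D` may be taken to be the complement of an up-set `U'` inside `U`; this turns (★3′) into an inequality
between FOUR UP-SETS with no auxiliary objects:

  (SPLICE)  `#((V \ U) ∩ B ∩ refl X) + #(U ∩ refl (B ∩ X)) ≤ #((V ∪ U) ∩ B ∩ X)`   for all up-sets `V, U, B, X`,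

i.e. inside the up-set `V ∪ U`, counting `B ∩ refl X` on the part outside `U` and `refl (B ∩ X)` on `U` never beats counting
`B ∩ X` everywhere.  `U = ∅` and `V ⊆ U` are the two Kleitman lemmas (`card_inter_refl_le` in `V ∩ B`, resp. for `B ∩ X` in `U`);
for nested `U ⊆ V` it reads `#(V ∩ B ∩ refl X) − #(V ∩ B ∩ X) ≤ #(U ∩ B ∩ refl X) − #(U ∩ refl (B ∩ X))` ("Kleitman-gap exchange":
the antipodal excess of `refl X` over `X` inside `V ∩ B` is at most the Kleitman gap of the SMALLER up-set `U` with respect to the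
down-set `refl (B ∩ X)`), and in Hall language (memo §1.3) it says: in the down-region `L \ U` the upward Kleitman matching
`B ∩ refl X → B ∩ X` has DEFICIENCY at most `#(U ∩ B ∩ X) − #(U ∩ refl (B ∩ X))`.

* `FiveUpSet.splice_le` — (SPLICE) on every finite cube (from `hybridKleitmanIneq_holds`, cut `D := univ \ U`);
* `FiveUpSet.splice_le_of_subset` — the nested form for `U ⊆ V`;
* `FiveUpSet.hybridKleitman_of_splice` — conversely (SPLICE) gives back (★3′) (cut `D` ↦ up-set `U \ D`), so (SPLICE) IS the open core;
* `LatticeFiveUpSet.SpliceIneqLattice` (`@[conjecture]`) — the same statement on a finite distributive lattice with an order-reversing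
  bijection `τ` (census of gen 35, exhaustive over all up-sets, τ = coordinate reversal / a poset anti-automorphism: products of chains
  `[3]²` (both antipodes), `[4]×[3]`, `[4]²`, `[5]×[3]`, `[3]×[2]×[2]` and `J(Q)` for the self-dual posets `N`, bowtie, `K₃,₃`, `X₅` — 0 violations;
  larger lattices in kit jobs j154865 / j155210; evidence only, NOT a proof);
  `LatticeFiveUpSet.splice_le_of_empty`, `LatticeFiveUpSet.splice_le_of_subset_left` — its two Kleitman endpoints, PROVED lattice-generally;
  `LatticeFiveUpSet.spliceIneqLattice_of_fiveUpSet : FiveUpSetIneqLattice → SpliceIneqLattice` — it is the three-set face of (♠_L).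
HONEST LABEL: an exact reformulation of a proved cube theorem plus a typed lattice conjecture with its trivial endpoints; nothing here
advances `TriWIneq` (a ≥ 2) or proves (♠_L). [this work]
-/

namespace Summit.CriticalPhenomena.PercolationContinuityZ3.Theorems

namespace FiveUpSet

open Finset

variable {α : Type} [DecidableEq α] [Fintype α]

omit [Fintype α] in
/-- The complement of an up-set (inside `univ`) is a down-set. [this work] -/
theorem isLowerSet_univ_sdiff [Fintype α] {U : Finset (Finset α)} (hU : IsUpperSet (U : Set (Finset α))) :
    IsLowerSet ((univ \ U : Finset (Finset α)) : Set (Finset α)) := by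
  intro s t hts hs
  rw [mem_coe, mem_sdiff] at hs ⊢
  exact ⟨mem_univ _, fun ht => hs.2 (hU hts ht)⟩

/-- **(SPLICE) on the cube.**  For up-sets `V, U, B, X` of a finite cube:
`#((V \ U) ∩ B ∩ refl X) + #(U ∩ refl (B ∩ X)) ≤ #((V ∪ U) ∩ B ∩ X)`.
Proof: the hybrid Kleitman inequality (`hybridKleitmanIneq_holds`) for the up-set `V ∪ U` with the cut `D := univ \ U`
(a down-set); inside `D` the hybrid of `B` is `B` and `(V ∪ U) ∩ D = V \ U`, outside `D` it is `refl B` and `(V ∪ U) \ D = U`. [this work] -/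
theorem splice_le (V U B X : Finset (Finset α)) (hV : IsUpperSet (V : Set (Finset α))) (hU : IsUpperSet (U : Set (Finset α)))
    (hB : IsUpperSet (B : Set (Finset α))) (hX : IsUpperSet (X : Set (Finset α))) :
    ((V \ U) ∩ B ∩ refl X).card + (U ∩ refl (B ∩ X)).card ≤ ((V ∪ U) ∩ B ∩ X).card := by
  have hVU : IsUpperSet ((V ∪ U : Finset (Finset α)) : Set (Finset α)) := by
    rw [coe_union]; exact hV.union hU
  have h := hybridKleitmanIneq_holds α (V ∪ U) X B (univ \ U) hVU hX hB (isLowerSet_univ_sdiff hU)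
  rw [card_inter_hybrid] at h
  have e1 : (V ∪ U) ∩ refl X ∩ (univ \ U) ∩ B = (V \ U) ∩ B ∩ refl X := by
    ext s
    simp only [mem_inter, mem_union, mem_sdiff, mem_univ, true_and]
    tauto
  have e2 : ((V ∪ U) ∩ refl X) \ (univ \ U) ∩ refl B = U ∩ refl (B ∩ X) := by
    ext s
    simp only [mem_inter, mem_union, mem_sdiff, mem_univ, true_and, refl_inter]
    tauto
  have e3 : (V ∪ U) ∩ X ∩ B = (V ∪ U) ∩ B ∩ X := by
    rw [inter_assoc, inter_comm X, ← inter_assoc]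
  rw [e1, e2, e3] at h
  exact h

/-- **(SPLICE), nested form** ("Kleitman-gap exchange").  For up-sets `U ⊆ V`, `B`, `X` of a finite cube:
`#(V ∩ B ∩ refl X) + #(U ∩ refl (B ∩ X)) ≤ #(V ∩ B ∩ X) + #(U ∩ B ∩ refl X)`, i.e. the excess of `refl X` over `X` inside `V ∩ B`
is at most `#(U ∩ B ∩ refl X) − #(U ∩ refl (B ∩ X))`.  `U = V`: Kleitman for `B ∩ X` in `U`; `U = ∅`: Kleitman for `X` in `V ∩ B`. [this work] -/
theorem splice_le_of_subset (V U B X : Finset (Finset α)) (hV : IsUpperSet (V : Set (Finset α)))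
    (hU : IsUpperSet (U : Set (Finset α))) (hB : IsUpperSet (B : Set (Finset α))) (hX : IsUpperSet (X : Set (Finset α)))
    (hUV : U ⊆ V) :
    (V ∩ B ∩ refl X).card + (U ∩ refl (B ∩ X)).card ≤ (V ∩ B ∩ X).card + (U ∩ B ∩ refl X).card := by
  have h := splice_le V U B X hV hU hB hX
  have hu : V ∪ U = V := union_eq_left.mpr hUV
  rw [hu] at h
  -- `V ∩ B ∩ refl X` splits into its parts outside and inside `U`
  have hsplit : (V ∩ B ∩ refl X).card = ((V \ U) ∩ B ∩ refl X).card + (U ∩ B ∩ refl X).card := by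
    have e : V ∩ B ∩ refl X = ((V \ U) ∩ B ∩ refl X) ∪ (U ∩ B ∩ refl X) := by
      ext s
      simp only [mem_inter, mem_union, mem_sdiff]
      constructor
      · rintro ⟨⟨hv, hb⟩, hx⟩
        by_cases hs : s ∈ U
        · exact Or.inr ⟨⟨hs, hb⟩, hx⟩
        · exact Or.inl ⟨⟨⟨hv, hs⟩, hb⟩, hx⟩
      · rintro (⟨⟨⟨hv, -⟩, hb⟩, hx⟩ | ⟨⟨hs, hb⟩, hx⟩)
        · exact ⟨⟨hv, hb⟩, hx⟩
        · exact ⟨⟨hUV hs, hb⟩, hx⟩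
    have d : Disjoint ((V \ U) ∩ B ∩ refl X) (U ∩ B ∩ refl X) := by
      rw [disjoint_left]
      intro s hs hs'
      simp only [mem_inter, mem_sdiff] at hs hs'
      exact hs.1.1.2 hs'.1.1
    rw [e, card_union_of_disjoint d]
  omega

/-- **(SPLICE) is the open core**: the splice inequality for all up-sets gives back the hybrid Kleitman inequality (★3′)
(hence, by `hybridKleitman_iff_threeUpSet`, the three-up-set face of (♠)): given a down-set cut `D`, apply (SPLICE) to
`V := U`, `U := U \ D` (an up-set). [this work] -/
theorem hybridKleitman_of_splice
    (h : ∀ (α : Type) [DecidableEq α] [Fintype α] (V U B X : Finset (Finset α)),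
      IsUpperSet (V : Set (Finset α)) → IsUpperSet (U : Set (Finset α)) → IsUpperSet (B : Set (Finset α)) →
      IsUpperSet (X : Set (Finset α)) →
        ((V \ U) ∩ B ∩ refl X).card + (U ∩ refl (B ∩ X)).card ≤ ((V ∪ U) ∩ B ∩ X).card) :
    HybridKleitmanIneq := by
  intro α _ _ U X B D hU hX hB hD
  have hUD : IsUpperSet ((U \ D : Finset (Finset α)) : Set (Finset α)) := isUpperSet_sdiff hU hD
  have hs := h α U (U \ D) B X hU hUD hB hX
  rw [card_inter_hybrid]
  have e1 : (U \ (U \ D)) ∩ B ∩ refl X = U ∩ refl X ∩ D ∩ B := by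
    ext s
    simp only [mem_inter, mem_sdiff]
    tauto
  have e2 : (U \ D) ∩ refl (B ∩ X) = (U ∩ refl X) \ D ∩ refl B := by
    ext s
    simp only [mem_inter, mem_sdiff, refl_inter]
    tauto
  have e3 : (U ∪ (U \ D)) ∩ B ∩ X = U ∩ X ∩ B := by
    ext s
    simp only [mem_inter, mem_union, mem_sdiff]
    tauto
  rw [e1, e2, e3] at hs
  exact hs

end FiveUpSet

namespace LatticeFiveUpSet

open Finset

variable {L : Type*} [DistribLattice L] [Fintype L] [DecidableEq L]

/-- **(SPLICE) endpoint `U = ∅` on a finite distributive lattice** (PROVED): `#(V ∩ B ∩ τX) ≤ #(V ∩ B ∩ X)` for up-sets `V, B, X` and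
an order-reversing bijection `τ` — Kleitman's lemma (`card_inter_image_le`) inside the up-set `V ∩ B`. [this work] -/
theorem splice_le_of_empty (τ : L ≃ L) (hτ : ∀ a b : L, τ a ≤ τ b ↔ b ≤ a) (V B X : Finset L)
    (hV : IsUpperSet (V : Set L)) (hB : IsUpperSet (B : Set L)) (hX : IsUpperSet (X : Set L)) :
    (V ∩ B ∩ X.image τ).card ≤ (V ∩ B ∩ X).card := by
  have hVB : IsUpperSet ((V ∩ B : Finset L) : Set L) := by rw [coe_inter]; exact hV.inter hB
  exact card_inter_image_le τ hτ (V ∩ B) X hVB hX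

/-- **(SPLICE) endpoint `V ⊆ U` on a finite distributive lattice** (PROVED): `#(U ∩ τ(B ∩ X)) ≤ #(U ∩ B ∩ X)` for up-sets `U, B, X`
(Kleitman's lemma for the up-set `B ∩ X` inside `U`). [this work] -/
theorem splice_le_of_subset_left (τ : L ≃ L) (hτ : ∀ a b : L, τ a ≤ τ b ↔ b ≤ a) (U B X : Finset L)
    (hU : IsUpperSet (U : Set L)) (hB : IsUpperSet (B : Set L)) (hX : IsUpperSet (X : Set L)) :
    (U ∩ (B ∩ X).image τ).card ≤ (U ∩ B ∩ X).card := by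
  have hBX : IsUpperSet ((B ∩ X : Finset L) : Set L) := by rw [coe_inter]; exact hB.inter hX
  have h := card_inter_image_le τ hτ U (B ∩ X) hU hBX
  rw [← inter_assoc] at h
  exact h

/-- **The splice inequality on a finite distributive lattice** (CONJECTURE — the three-set face of (♠_L) `FiveUpSetIneqLattice`; an
obligation of our theories, never a fact): for every finite distributive lattice `L`, every order-reversing bijection `τ`, and up-sets
`V, U, B, X`: `#((V \ U) ∩ B ∩ τX) + #(U ∩ τ(B ∩ X)) ≤ #((V ∪ U) ∩ B ∩ X)`.  On cubes it is the theorem `FiveUpSet.splice_le`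
(rank proof, cube-specific); lattice census (prim-lf-1 gen 35, local, τ = coordinate reversal / a poset anti-automorphism), exhaustive over
all quadruples of up-sets: `[3]²` (160,000; both antipodes), `[4]×[3]` (1,500,625), `[4]²`, `[5]×[3]`, `[3]×[2]×[2]`, `J(N)`, `J(bowtie)`, `J(K₃,₃)`,
`J(X₅)`: 0 violations; larger products of chains in kit jobs j154865 / j155210 (memo FROM-prim-lf-1-gen35 §1 has the table).  In matching
language (memo §2, equivalent by Hall's theorem): ONE upward injection `B ∩ τX ↪ B ∩ X` serves every cut `U` at once. OPEN. [this work] -/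
@[conjecture] def SpliceIneqLattice : Prop :=
  ∀ (L : Type) [DistribLattice L] [Fintype L] [DecidableEq L] (τ : L ≃ L), (∀ a b : L, τ a ≤ τ b ↔ b ≤ a) →
    ∀ (V U B X : Finset L),
    IsUpperSet (V : Set L) → IsUpperSet (U : Set L) → IsUpperSet (B : Set L) → IsUpperSet (X : Set L) →
      ((V \ U) ∩ B ∩ X.image τ).card + (U ∩ (B ∩ X).image τ).card ≤ ((V ∪ U) ∩ B ∩ X).card

/-- **(♠_L) implies the lattice splice inequality** — it is the face `B₀ = ∅` of `FiveUpSetIneqLattice`, re-cut.  Given up-sets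
`V, U, B, X` apply (♠_L) to `P := V ∪ U`, `A₁ := X`, `B₀ := ∅`, `B₁ := B` and `A₀ := {x ∈ X | τ x ∉ U}` — an UP-SET (`x ≤ y` gives
`τ y ≤ τ x`, and `τ x ∉ U` is inherited downward along `τ`), `A₀ ⊆ X`.  Then `P ∩ τA₀ ∩ B = (V \ U) ∩ B ∩ τX`,
`P ∩ τ(X \ A₀) ∩ τB = U ∩ τ(B ∩ X)` (injectivity of `τ`) and `P ∩ A₁ ∩ B = (V ∪ U) ∩ B ∩ X`; the two `∅`-terms vanish.
No involutivity of `τ` is needed. [this work] -/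
theorem splice_of_fiveUpSetIneqLattice (h : FiveUpSetIneqLattice) (L : Type) [DistribLattice L] [Fintype L] [DecidableEq L]
    (τ : L ≃ L) (hτ : ∀ a b : L, τ a ≤ τ b ↔ b ≤ a) (V U B X : Finset L)
    (hV : IsUpperSet (V : Set L)) (hU : IsUpperSet (U : Set L)) (hB : IsUpperSet (B : Set L)) (hX : IsUpperSet (X : Set L)) :
    ((V \ U) ∩ B ∩ X.image τ).card + (U ∩ (B ∩ X).image τ).card ≤ ((V ∪ U) ∩ B ∩ X).card := by
  classical
  set P : Finset L := V ∪ U with hP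
  set A₀ : Finset L := X.filter (fun x => τ x ∉ U) with hA₀
  have hPup : IsUpperSet (P : Set L) := by rw [hP, coe_union]; exact hV.union hU
  have hA₀up : IsUpperSet (A₀ : Set L) := by
    intro x y hxy hx
    rw [mem_coe, hA₀, mem_filter] at hx ⊢
    refine ⟨hX hxy hx.1, fun hy => hx.2 ?_⟩
    have : τ y ≤ τ x := (hτ y x).2 hxy
    exact hU this hy
  have hA₀X : A₀ ⊆ X := filter_subset _ _
  have hE : IsUpperSet ((∅ : Finset L) : Set L) := by intro a b _ ha; simp at ha
  have key := h L τ hτ P A₀ X ∅ B hPup hA₀up hX hE hB hA₀X (empty_subset B)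
  simp only [image_empty, inter_empty, card_empty, zero_add, add_zero, sdiff_empty] at key
  -- identify the three remaining terms
  have t1 : P ∩ A₀.image τ ∩ B = (V \ U) ∩ B ∩ X.image τ := by
    ext s
    simp only [hP, hA₀, mem_inter, mem_union, mem_sdiff, mem_image, mem_filter]
    constructor
    · rintro ⟨⟨hs, ⟨x, ⟨hxX, hxU⟩, rfl⟩⟩, hb⟩
      refine ⟨⟨⟨?_, hxU⟩, hb⟩, ⟨x, hxX, rfl⟩⟩
      rcases hs with hv | hu
      · exact hv
      · exact absurd hu hxU
    · rintro ⟨⟨⟨hv, hnu⟩, hb⟩, ⟨x, hxX, rfl⟩⟩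
      exact ⟨⟨Or.inl hv, ⟨x, ⟨hxX, hnu⟩, rfl⟩⟩, hb⟩
  have t2 : P ∩ (X \ A₀).image τ ∩ B.image τ = U ∩ (B ∩ X).image τ := by
    ext s
    simp only [hP, hA₀, mem_inter, mem_union, mem_sdiff, mem_image, mem_filter, not_and, not_not]
    constructor
    · rintro ⟨⟨-, ⟨x, ⟨hxX, hxU⟩, rfl⟩⟩, ⟨b, hb, hbx⟩⟩
      have hbx' : b = x := τ.injective hbx
      subst hbx'
      exact ⟨hxU hxX, ⟨b, ⟨hb, hxX⟩, rfl⟩⟩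
    · rintro ⟨hu, ⟨x, ⟨hxB, hxX⟩, rfl⟩⟩
      exact ⟨⟨Or.inr hu, ⟨x, ⟨hxX, fun _ => hu⟩, rfl⟩⟩, ⟨x, hxB, rfl⟩⟩
  have t3 : P ∩ X ∩ B = (V ∪ U) ∩ B ∩ X := by
    rw [hP, inter_assoc, inter_comm X, ← inter_assoc]
  rw [t1, t2, t3] at key
  exact key

/-- `FiveUpSetIneqLattice → SpliceIneqLattice`: the lattice splice conjecture is a face of (♠_L). [this work] -/
theorem spliceIneqLattice_of_fiveUpSet (h : FiveUpSetIneqLattice) : SpliceIneqLattice := by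
  intro L _ _ _ τ hτ V U B X hV hU hB hX
  exact splice_of_fiveUpSetIneqLattice h L τ hτ V U B X hV hU hB hX

/-- The cube with complementation satisfies the lattice splice statement (via `FiveUpSet.splice_le`; `refl 𝒜 = 𝒜.image compl`):
for up-sets `V, U, B, X` of `Finset α`, `#((V \ U) ∩ B ∩ X.image compl) + #(U ∩ (B ∩ X).image compl) ≤ #((V ∪ U) ∩ B ∩ X)`. [this work] -/
theorem splice_le_cube (α : Type) [DecidableEq α] [Fintype α] (V U B X : Finset (Finset α))
    (hV : IsUpperSet (V : Set (Finset α))) (hU : IsUpperSet (U : Set (Finset α)))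
    (hB : IsUpperSet (B : Set (Finset α))) (hX : IsUpperSet (X : Set (Finset α))) :
    ((V \ U) ∩ B ∩ X.image (⟨compl, compl, compl_compl, compl_compl⟩ : Finset α ≃ Finset α)).card
        + (U ∩ (B ∩ X).image (⟨compl, compl, compl_compl, compl_compl⟩ : Finset α ≃ Finset α)).card
      ≤ ((V ∪ U) ∩ B ∩ X).card := by
  have er : ∀ 𝒜 : Finset (Finset α),
      𝒜.image (⟨compl, compl, compl_compl, compl_compl⟩ : Finset α ≃ Finset α) = FiveUpSet.refl 𝒜 := by
    intro 𝒜
    ext s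
    rw [FiveUpSet.mem_refl, mem_image]
    constructor
    · rintro ⟨t, ht, rfl⟩; simpa using ht
    · intro hs; exact ⟨sᶜ, hs, compl_compl s⟩
  rw [er, er]
  exact FiveUpSet.splice_le V U B X hV hU hB hX

end LatticeFiveUpSet

end Summit.CriticalPhenomena.PercolationContinuityZ3.Theorems
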